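import Literature.NumberTheory.Automorphic.ModularEisensteinFourier
import Literature.NumberTheory.LFunctions.ZetaOneLineBounds
import Literature.NumberTheory.LFunctions.ZetaClassicalRegionBounds
import Literature.NumberTheory.LFunctions.LevinsonMontgomeryBacklund
import Literature.Analysis.SpecialFunctions.GammaStirlingOrder
import HarnessLib

/-!
# Polynomial growth of the scattering coefficient `φ(s) = Λ(2s-1)/Λ(2s)` of `SL₂(ℤ)` on `½ ≤ Re s ≤ 3/2`

Layer 26 of the proof of Selberg's lattice-point theorem for the modular group
(`Literature.NumberTheory.Automorphic.sl2BallCount_asymp`). For the spectral decomposition of the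
space of incomplete Eisenstein series (Iwaniec, Theorem 7.3) one moves a line of integration from
`Re s = σ' > 1` to `Re s = ½` (Iwaniec (7.11) → (7.12)); for `Γ = SL₂(ℤ)` the only analytic input
needed for this is that the scattering coefficient `φ(s) = √π Γ(s-½)ζ(2s-1)/(Γ(s)ζ(2s))` ((3.24))
has at most polynomial growth in `|Im s|` on the strip, which we assemble here from the tree's
explicit bounds: `|Γ(x+iy)| ≤ 16π²(1+|y|)^{3/2}e^{-π|y|/2}` (`0 < x ≤ 2`) and
`|Γ(x+iy)| ≥ (2/15)e^{-π|y|/2}` (`½ ≤ x ≤ 5/2`) (`GammaStirlingOrder.lean`), `|ζ(w)| ≤ (|w|+2)³`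
(`Re w ≥ -1`, `LevinsonMontgomeryBacklund.lean`), and the classical `|ζ(σ+it)| ≥ 168/(K log⁷|t|)` for
`1 ≤ σ ≤ 2` (`ZetaOneLineBounds.lean`, Titchmarsh (3.6.5)). Result: `|φ(s)| ≤ C|Im s|¹¹` for
`½ ≤ Re s ≤ 3/2`, `|Im s| ≥ 4` (`exists_norm_scatPhi_le`), and `|φ(s)| ≤ C(1+|Im s|)¹¹` on the strip
away from the pole `s = 1` (`exists_norm_scatPhi_le_on_strip`).

## References

* [Iwaniec2002] H. Iwaniec, *Spectral Methods of Automorphic Forms*, 2nd ed., AMS GSM 53 (2002),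
  (3.24) PDF p. 46 and §7.3 (the contour shift to (7.12)), PDF p. 98.
* [Titchmarsh1986] E. C. Titchmarsh, *The Theory of the Riemann Zeta-function*, 2nd ed. (1986),
  §3.6 (3.6.5).
-/

noncomputable section

open Real Complex


namespace Literature.NumberTheory.Automorphic

open Literature.NumberTheory.LFunctions (norm_riemannZeta_le_cube)
open Literature.NumberTheory.LFunctions.ZetaOneLine (norm_riemannZeta_ge_inv_log_pow_seven)
open Literature.NumberTheory.LFunctions.ZetaClassicalRegion (norm_riemannZeta_ge_of_one_lt_re)
open Literature.Analysis.SpecialFunctions (norm_Gamma_ge_exp norm_Gamma_le_exp_of_le_two)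

section Growth

/-- `Λ(w) = Γ_ℝ(w) ζ(w)` whenever `w ≠ 0` and `Γ_ℝ(w) ≠ 0`. [folklore] -/
theorem completedRiemannZeta_eq_Gammaℝ_mul {w : ℂ} (hw : w ≠ 0) (hΓ : Complex.Gammaℝ w ≠ 0) :
    completedRiemannZeta w = Complex.Gammaℝ w * riemannZeta w := by
  rw [riemannZeta_def_of_ne_zero hw, mul_div_cancel₀ _ hΓ]

/-- `Γ(z) ≠ 0` off the real axis. [folklore] -/
theorem Gamma_ne_zero_of_im_ne_zero {z : ℂ} (hz : z.im ≠ 0) : Complex.Gamma z ≠ 0 := by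
  refine Complex.Gamma_ne_zero fun m h => hz ?_
  rw [h]; simp

/-- **`φ(s) = √π Γ(s-½) ζ(2s-1) / (Γ(s) ζ(2s))`** (Iwaniec (3.24)) wherever `Re s > 0`,
`s ≠ ½, 1` and `Γ(s - ½)` is finite and non-zero. [cite: Iwaniec2002, (3.24), PDF p. 46] -/
theorem scatPhi_eq_Gamma_zeta {s : ℂ} (hs : 0 < s.re) (h1 : s ≠ 1) (hh : s ≠ 1 / 2)
    (hΓ' : Complex.Gamma (s - 1 / 2) ≠ 0) :
    scatPhi s = ((Real.sqrt π : ℝ) : ℂ) * Complex.Gamma (s - 1 / 2) * riemannZeta (2 * s - 1) /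
      (Complex.Gamma s * riemannZeta (2 * s)) := by
  have h0 : s ≠ 0 := fun h => by rw [h, Complex.zero_re] at hs; exact lt_irrefl _ hs
  have hπ : (π : ℂ) ≠ 0 := by exact_mod_cast Real.pi_pos.ne'
  rw [scatPhi_eq h0 h1 hh, completedRiemannZeta_two_mul hs]
  have hw : 2 * s - 1 ≠ 0 := fun h => hh (by linear_combination h / 2)
  have hG : Complex.Gammaℝ (2 * s - 1) = (π : ℂ) ^ (-s) * ((Real.sqrt π : ℝ) : ℂ) * Complex.Gamma (s - 1 / 2) := by
    rw [Complex.Gammaℝ_def, show (2 * s - 1) / 2 = s - 1 / 2 by ring,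
      show -(2 * s - 1) / 2 = -s + 1 / 2 by ring, Complex.cpow_add _ _ hπ, Real.sqrt_eq_rpow,
      Complex.ofReal_cpow Real.pi_pos.le]
    push_cast
    ring
  have hGne : Complex.Gammaℝ (2 * s - 1) ≠ 0 := by
    rw [hG]
    refine mul_ne_zero (mul_ne_zero (Complex.cpow_ne_zero_iff.mpr (Or.inl hπ)) ?_) hΓ'
    exact_mod_cast (Real.sqrt_pos.mpr Real.pi_pos).ne'
  rw [completedRiemannZeta_eq_Gammaℝ_mul hw hGne, hG]
  have hπs : (π : ℂ) ^ (-s) ≠ 0 := Complex.cpow_ne_zero_iff.mpr (Or.inl hπ)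
  field_simp

/-- The factorisation on `Re s ≥ ½`, `Im s ≠ 0`. [cite: Iwaniec2002, (3.24), PDF p. 46] -/
theorem scatPhi_eq_Gamma_zeta_of_im_ne_zero {s : ℂ} (hs : 1 / 2 ≤ s.re) (him : s.im ≠ 0) :
    scatPhi s = ((Real.sqrt π : ℝ) : ℂ) * Complex.Gamma (s - 1 / 2) * riemannZeta (2 * s - 1) /
      (Complex.Gamma s * riemannZeta (2 * s)) :=
  scatPhi_eq_Gamma_zeta (by linarith) (fun h => him (by rw [h]; simp)) (fun h => him (by rw [h]; simp))
    (Gamma_ne_zero_of_im_ne_zero (by simpa using him))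

/-- The factorisation on `Re s > 1` (in particular for real `s > 1`). [cite: Iwaniec2002, (3.24), PDF p. 46] -/
theorem scatPhi_eq_Gamma_zeta_of_one_lt_re {s : ℂ} (hs : 1 < s.re) :
    scatPhi s = ((Real.sqrt π : ℝ) : ℂ) * Complex.Gamma (s - 1 / 2) * riemannZeta (2 * s - 1) /
      (Complex.Gamma s * riemannZeta (2 * s)) :=
  scatPhi_eq_Gamma_zeta (by linarith) (fun h => by rw [h, Complex.one_re] at hs; exact lt_irrefl _ hs)
    (fun h => by rw [h] at hs; norm_num at hs)
    (Complex.Gamma_ne_zero_of_re_pos (by simp; linarith))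

/-- Titchmarsh's constant `K = 1134·16·336⁴` of the tree's `1/ζ ≪ log⁷` bound. [folklore] -/
theorem zetaK_pos : (0 : ℝ) < 1134 * 16 * 336 ^ 4 := by norm_num

/-- **Lower bound for `ζ(2s)` on `½ ≤ Re s ≤ 3/2`, `|Im s| ≥ 4`**: `|ζ(2s)| ≥ 168/(K log⁷(2|t|))`
(the classical `1/ζ(σ+it) ≪ log⁷ t` for `σ ≥ 1`, here from the tree's
`ZetaOneLine.norm_riemannZeta_ge_inv_log_pow_seven`, and `|ζ| ≥ ½` for `Re ≥ 2`).
[cite: Titchmarsh1986, §3.6 (3.6.5)] -/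
theorem norm_riemannZeta_two_mul_ge {s : ℂ} (hs : 1 / 2 ≤ s.re) (hs' : s.re ≤ 3 / 2) (hT : 4 ≤ |s.im|) :
    168 / ((1134 * 16 * 336 ^ 4) * Real.log |2 * s.im| ^ 7) ≤ ‖riemannZeta (2 * s)‖ := by
  have him2 : (2 * s).im = 2 * s.im := by simp
  have hre2 : (2 * s).re = 2 * s.re := by simp
  have hT2 : 4 ≤ |(2 * s).im| := by rw [him2, abs_mul, abs_two]; linarith [abs_nonneg s.im]
  have hL : 2 ≤ Real.log |2 * s.im| := by
    rw [abs_mul, abs_two]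
    have h8 : (8 : ℝ) ≤ 2 * |s.im| := by linarith
    calc (2 : ℝ) ≤ Real.log 8 := by
          rw [show (8 : ℝ) = 2 ^ (3 : ℕ) by norm_num, Real.log_pow]
          have := Real.log_two_gt_d9; norm_num at this ⊢; linarith
      _ ≤ Real.log (2 * |s.im|) := Real.log_le_log (by norm_num) h8
  rcases le_or_gt s.re 1 with h1 | h1
  · have h := norm_riemannZeta_ge_inv_log_pow_seven (s := 2 * s) hT2 ?_ (by rw [hre2]; linarith)
    · rwa [him2] at h
    · rw [hre2, him2]
      have : 0 ≤ 1 / (2 * (1134 * 16 * 336 ^ 4) * Real.log |2 * s.im| ^ 9) := by positivity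
      linarith
  · have h := norm_riemannZeta_ge_of_one_lt_re (s := 2 * s) (by rw [hre2]; linarith)
    rw [hre2] at h
    have hhalf : (1 : ℝ) / 2 ≤ (2 * s.re - 1) / (2 * s.re) := by
      rw [div_le_div_iff₀ (by norm_num) (by linarith)]; linarith
    refine le_trans ?_ (hhalf.trans h)
    rw [div_le_div_iff₀ (by positivity) (by norm_num)]
    have hL7 : (2 : ℝ) ^ 7 ≤ Real.log |2 * s.im| ^ 7 := by gcongr
    nlinarith [hL7]

/-- **Polynomial growth of the scattering coefficient**: for `½ ≤ Re s ≤ 3/2` and `|Im s| ≥ 4`,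
`|φ(s)| ≤ C |Im s|¹¹` (from `|Γ(s-½)/Γ(s)| ≪ |t|^{½}`, `ζ(2s-1) ≪ |t|³` in `0 ≤ Re ≤ 2`, and
`1/ζ(2s) ≪ log⁷|t|` on `Re 2s ≥ 1`). This is what makes the contour shift (7.11) → (7.12) legitimate
for the modular group. [cite: Iwaniec2002, §7.3 (7.12), PDF p. 98; Titchmarsh1986, §3.6 (3.6.5)] -/
theorem exists_norm_scatPhi_le :
    ∃ C : ℝ, 0 < C ∧ ∀ s : ℂ, 1 / 2 ≤ s.re → s.re ≤ 3 / 2 → 4 ≤ |s.im| → ‖scatPhi s‖ ≤ C * |s.im| ^ 11 := by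
  set K : ℝ := 1134 * 16 * 336 ^ 4 with hK
  refine ⟨Real.sqrt π * (16 * π ^ 2 * 4) * 64 * (15 / 2) * (K * 128 / 168), by positivity, ?_⟩
  intro s hs hs' hT
  set σ := s.re with hσ
  set t := s.im with ht
  have hT1 : 1 ≤ |t| := by linarith
  have hT0 : 0 < |t| := by linarith
  have him : s.im ≠ 0 := fun h => by rw [ht.trans h, abs_zero] at hT; linarith
  have hs_eq : s = (σ : ℂ) + (t : ℂ) * Complex.I := by rw [hσ, ht, Complex.re_add_im]
  rw [scatPhi_eq_Gamma_zeta_of_im_ne_zero hs him, norm_div, norm_mul, norm_mul, norm_mul, Complex.norm_real, Real.norm_eq_abs,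
    abs_of_pos (Real.sqrt_pos.mpr Real.pi_pos)]
  -- (a) `|Γ(s - ½)| ≤ 16π²(1+|t|)^{3/2} e^{-π|t|/2} / |t|`
  have hz : s - 1 / 2 ≠ 0 := fun h => him (by have := congrArg Complex.im h; simpa using this)
  have hΓshift : Complex.Gamma (s - 1 / 2) = Complex.Gamma (s + 1 / 2) / (s - 1 / 2) := by
    have h := Complex.Gamma_add_one (s - 1 / 2) hz
    rw [show s - 1 / 2 + 1 = s + 1 / 2 by ring] at h
    rw [h, mul_div_cancel_left₀ _ hz]
  have ha : ‖Complex.Gamma (s - 1 / 2)‖ ≤ 16 * π ^ 2 * (1 + |t|) ^ (3 / 2 : ℝ) * Real.exp (-(π * |t|) / 2) / |t| := by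
    rw [hΓshift, norm_div]
    have hnum : ‖Complex.Gamma (s + 1 / 2)‖ ≤ 16 * π ^ 2 * (1 + |t|) ^ (3 / 2 : ℝ) * Real.exp (-(π * |t|) / 2) := by
      have e : s + 1 / 2 = ((σ + 1 / 2 : ℝ) : ℂ) + (t : ℂ) * Complex.I := by rw [hs_eq]; push_cast; ring
      rw [e]
      exact norm_Gamma_le_exp_of_le_two (by linarith) (by linarith) hT1
    have hden : |t| ≤ ‖s - 1 / 2‖ := by
      have : (s - 1 / 2).im = t := by simp [ht]
      rw [← this]; exact Complex.abs_im_le_norm _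
    calc ‖Complex.Gamma (s + 1 / 2)‖ / ‖s - 1 / 2‖ ≤ (16 * π ^ 2 * (1 + |t|) ^ (3 / 2 : ℝ) * Real.exp (-(π * |t|) / 2)) / |t| := by
          gcongr
      _ = _ := rfl
  -- (b) `|Γ(s)| ≥ (2/15) e^{-π|t|/2}`
  have hb : 2 / 15 * Real.exp (-(π * |t|) / 2) ≤ ‖Complex.Gamma s‖ := by
    rw [hs_eq]; exact norm_Gamma_ge_exp hs (by linarith) t
  -- (c) `|ζ(2s-1)| ≤ (|2s-1|+2)³ ≤ 64|t|³`
  have hc : ‖riemannZeta (2 * s - 1)‖ ≤ 64 * |t| ^ 3 := by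
    have h1 : -1 ≤ (2 * s - 1).re := by simp [← hσ]; linarith
    have h2 : 1 ≤ ‖(2 * s - 1) - 1‖ := by
      have : (2 * s - 1 - 1).im = 2 * t := by simp [ht]
      calc (1 : ℝ) ≤ |2 * t| := by rw [abs_mul, abs_two]; linarith
        _ = |(2 * s - 1 - 1).im| := by rw [this]
        _ ≤ ‖2 * s - 1 - 1‖ := Complex.abs_im_le_norm _
    refine (norm_riemannZeta_le_cube h1 h2).trans ?_
    have hn : ‖2 * s - 1‖ + 2 ≤ 4 * |t| := by
      have : ‖2 * s - 1‖ ≤ ‖(2 : ℂ) * s‖ + ‖(1 : ℂ)‖ := norm_sub_le _ _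
      rw [norm_mul, Complex.norm_two, norm_one] at this
      have hs_norm : ‖s‖ ≤ |σ| + |t| := by
        rw [hs_eq]
        refine (norm_add_le _ _).trans ?_
        rw [norm_mul, Complex.norm_I, mul_one, Complex.norm_real, Complex.norm_real, Real.norm_eq_abs, Real.norm_eq_abs]
      have : |σ| ≤ 3 / 2 := abs_le.mpr ⟨by linarith, hs'⟩
      linarith
    calc (‖2 * s - 1‖ + 2) ^ 3 ≤ (4 * |t|) ^ 3 := by gcongr
      _ = 64 * |t| ^ 3 := by ring
  -- (d) `|ζ(2s)| ≥ 168/(K log⁷(2|t|))`, and `log(2|t|) ≤ 2|t|`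
  have hd := norm_riemannZeta_two_mul_ge hs hs' hT
  rw [← hK, ← ht] at hd
  have hL0 : 0 < Real.log |2 * t| := by
    rw [abs_mul, abs_two]; exact Real.log_pos (by linarith)
  have hLle : Real.log |2 * t| ≤ 2 * |t| := by
    rw [abs_mul, abs_two]; exact (Real.log_le_sub_one_of_pos (by linarith)).trans (by linarith)
  have hζpos : 0 < ‖riemannZeta (2 * s)‖ := lt_of_lt_of_le (by positivity) hd
  have hΓpos : 0 < ‖Complex.Gamma s‖ := lt_of_lt_of_le (by positivity) hb
  -- (e) `(1+|t|)^{3/2} ≤ 4|t|²`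
  have he : (1 + |t|) ^ (3 / 2 : ℝ) ≤ 4 * |t| ^ 2 := by
    calc (1 + |t|) ^ (3 / 2 : ℝ) ≤ (1 + |t|) ^ (2 : ℝ) := Real.rpow_le_rpow_of_exponent_le (by linarith) (by norm_num)
      _ = (1 + |t|) ^ 2 := by rw [Real.rpow_two]
      _ ≤ (2 * |t|) ^ 2 := by gcongr; linarith
      _ = 4 * |t| ^ 2 := by ring
  -- assemble
  rw [div_le_iff₀ (mul_pos hΓpos hζpos)]
  have hE : 0 < Real.exp (-(π * |t|) / 2) := Real.exp_pos _
  calc Real.sqrt π * ‖Complex.Gamma (s - 1 / 2)‖ * ‖riemannZeta (2 * s - 1)‖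
      ≤ Real.sqrt π * (16 * π ^ 2 * (4 * |t| ^ 2) * Real.exp (-(π * |t|) / 2) / |t|) * (64 * |t| ^ 3) := by
        gcongr
        calc ‖Complex.Gamma (s - 1 / 2)‖ ≤ 16 * π ^ 2 * (1 + |t|) ^ (3 / 2 : ℝ) * Real.exp (-(π * |t|) / 2) / |t| := ha
          _ ≤ 16 * π ^ 2 * (4 * |t| ^ 2) * Real.exp (-(π * |t|) / 2) / |t| := by gcongr
    _ = (Real.sqrt π * (16 * π ^ 2 * 4) * 64 * |t| ^ 4) * Real.exp (-(π * |t|) / 2) := by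
        field_simp
    _ ≤ (Real.sqrt π * (16 * π ^ 2 * 4) * 64 * |t| ^ 4) * Real.exp (-(π * |t|) / 2) *
          ((15 / 2 * ‖Complex.Gamma s‖ / Real.exp (-(π * |t|) / 2)) *
            (‖riemannZeta (2 * s)‖ * (K * Real.log |2 * t| ^ 7) / 168)) := by
        refine le_mul_of_one_le_right (by positivity) ?_
        have h1 : 1 ≤ 15 / 2 * ‖Complex.Gamma s‖ / Real.exp (-(π * |t|) / 2) := by
          rw [le_div_iff₀ hE]; linarith
        have h2 : 1 ≤ ‖riemannZeta (2 * s)‖ * (K * Real.log |2 * t| ^ 7) / 168 := by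
          rw [le_div_iff₀ (by norm_num)]
          have := (div_le_iff₀ (by positivity)).mp hd
          linarith
        nlinarith
    _ = Real.sqrt π * (16 * π ^ 2 * 4) * 64 * (15 / 2) * (K / 168) * (|t| ^ 4 * Real.log |2 * t| ^ 7) *
          (‖Complex.Gamma s‖ * ‖riemannZeta (2 * s)‖) := by
        field_simp
    _ ≤ Real.sqrt π * (16 * π ^ 2 * 4) * 64 * (15 / 2) * (K / 168) * (|t| ^ 4 * (2 * |t|) ^ 7) *
          (‖Complex.Gamma s‖ * ‖riemannZeta (2 * s)‖) := by
        gcongr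
    _ = Real.sqrt π * (16 * π ^ 2 * 4) * 64 * (15 / 2) * (K * 128 / 168) * |t| ^ 11 *
          (‖Complex.Gamma s‖ * ‖riemannZeta (2 * s)‖) := by ring

/-- **`φ` is bounded on the line `Re s = σ'` for `1 < σ' ≤ 3/2`** (continuity on `|t| ≤ 4` and the
polynomial bound beyond give local boundedness; here the crude global form `|φ(σ'+it)| ≤ C(1+|t|)¹¹`).
[folklore] -/
theorem exists_norm_scatPhi_le_on_strip :
    ∃ C : ℝ, 0 < C ∧ ∀ s : ℂ, 1 / 2 ≤ s.re → s.re ≤ 3 / 2 → s ≠ 1 → 4 ≤ |s.im| ∨ ‖s - 1‖ ≥ 1 / 4 →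
      ‖scatPhi s‖ ≤ C * (1 + |s.im|) ^ 11 := by
  obtain ⟨C, hC, hbound⟩ := exists_norm_scatPhi_le
  -- on the compact set `{½ ≤ σ ≤ 3/2, |t| ≤ 4, |s - 1| ≥ 1/4}` the continuous `φ` is bounded
  set Kc : Set ℂ := {s : ℂ | 1 / 2 ≤ s.re ∧ s.re ≤ 3 / 2 ∧ |s.im| ≤ 4 ∧ 1 / 4 ≤ ‖s - 1‖} with hKc
  have hKcomp : IsCompact Kc := by
    have hclosed : IsClosed Kc := by
      refine IsClosed.inter (isClosed_le continuous_const Complex.continuous_re) (IsClosed.inter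
        (isClosed_le Complex.continuous_re continuous_const) (IsClosed.inter
        (isClosed_le (continuous_abs.comp Complex.continuous_im) continuous_const)
        (isClosed_le continuous_const (continuous_norm.comp (continuous_id.sub continuous_const)))))
    refine Metric.isCompact_of_isClosed_isBounded hclosed ?_
    refine (Metric.isBounded_closedBall (x := (0 : ℂ)) (r := 6)).subset fun s hs => ?_
    rw [Metric.mem_closedBall, dist_zero_right]
    calc ‖s‖ ≤ |s.re| + |s.im| := Complex.norm_le_abs_re_add_abs_im s
      _ ≤ 3 / 2 + 4 := add_le_add (abs_le.mpr ⟨by linarith [hs.1], hs.2.1⟩) hs.2.2.1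
      _ ≤ 6 := by norm_num
  have hcont : ContinuousOn scatPhi Kc := by
    intro s hs
    exact (differentiableAt_scatPhi_of_half_le_re hs.1 (fun h => by
      have := hs.2.2.2; rw [h, sub_self, norm_zero] at this; linarith)).continuousAt.continuousWithinAt
  obtain ⟨B, hB⟩ := hKcomp.exists_bound_of_continuousOn hcont
  set M : ℝ := max C (max B 0) with hM
  have hCM : C ≤ M := le_max_left _ _
  have hBM : B ≤ M := (le_max_left _ _).trans (le_max_right _ _)
  have hM0 : 0 ≤ M := (le_max_right _ _).trans (le_max_right _ _)
  refine ⟨M, lt_of_lt_of_le hC hCM, fun s hs hs' _ halt => ?_⟩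
  have h1t : 1 ≤ 1 + |s.im| := by linarith [abs_nonneg s.im]
  rcases le_or_gt 4 |s.im| with hT | hT
  · calc ‖scatPhi s‖ ≤ C * |s.im| ^ 11 := hbound s hs hs' hT
      _ ≤ M * (1 + |s.im|) ^ 11 :=
          mul_le_mul hCM (pow_le_pow_left₀ (abs_nonneg _) (by linarith) 11) (by positivity) hM0
  · have hmem : s ∈ Kc := ⟨hs, hs', hT.le, halt.resolve_left (not_le.mpr hT)⟩
    calc ‖scatPhi s‖ ≤ B := hB s hmem
      _ ≤ M := hBM
      _ ≤ M * (1 + |s.im|) ^ 11 := le_mul_of_one_le_right hM0 (one_le_pow₀ h1t)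

end Growth

end Literature.NumberTheory.Automorphic
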